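import Summits.ResolutionOfSingularities.ResolutionOfSingularities.Theorems.ShallowCutChart

/-!
# ShallowCutFrame — a uniformly cone-shallow curve on a regular scheme: frames, regularity of the reduced curve, and
the invariant `(𝓘𝒪 : 𝓘_Eⁿ) ⊄ 𝔪ⁿ` at every point of the curve blow-up over the curve (slice 3/4 of the node «ShallowCut»)

`decomp-res-lens-2`, generation 32; engine letter (C) `PinchCut.FlatConeExit` (proved in slice 4/4
`MaxContactCutShallowCut`).  Scheme-level lemmas over the tree's `IsConeShallowAt` / `IsCurvePt` / `curvePrime`:

* `cone_stalkIdeal_le` — at a cone-shallow closed point `𝓘_y ⊆ 𝔭ⁿ` and `𝔭 ⊆ 𝔪`;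
* `isRsopPart_of_isConeShallowAt` — the frame `c` (any length `d + 1`) is part of a regular system of parameters
  (`(c, v) = 𝔪`, `spanFinrank 𝔪 = d + 2`, `isRsopPart_comp_of_rsop`);
* `isRegular_coneCurve_subscheme` — the reduced curve `V(𝓘_{closure {η}})` is a regular scheme;
* `coneInv_closed` — over a CLOSED point of the curve, at every point `x'` of `Bl_C Y` the controlled transform is not
  inside `𝔪_{x'}ⁿ` (chart dictionary `IsBlowup.exists_reesChart_stalk` + the chart law `cone_chart`, valid at every
  prime of the chart over `𝔪_y`, closed or not);
* `coneInv_eta` — over the GENERIC point `η`: by PROPERNESS of the blow-up (`IsBlowup.isProper`,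
  `TowerCut.exists_specializes_over`) a point `x'` over `η` specialises to a point `x''` over a closed point `y₀` of
  the curve, and `𝓘_{x'} ⊆ 𝔪_{x'}ⁿ` would persist at `x''` by the hypothesis-free POINTWISE Zariski–Nagata lemma
  `stalkIdeal_le_pow_of_specializes` (regularity of `𝒪_{x''}` only), contradicting `coneInv_closed` at `x''`.

Sources: [Hironaka1964] Ch. III §1 (`𝔭⁽ⁿ⁾ ⊆ 𝔪ⁿ`, permissible blow-ups); [CossartJannsenSaito2020] Ch. 2, Ch. 8;
[CossartPiltant2008] Prop. 4.2 (a); [Matsumura1987] Thms. 14.2, 16.2; [StacksProject, Tags 0804, 01W0].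
-/

open IsLocalRing
open Literature.AlgebraicGeometry.Resolution

namespace Summit.ResolutionOfSingularities.ResolutionOfSingularities.Theorems.ShallowCut

/-! ## §6  The cone-shallow curve on a regular scheme and the invariant after its blow-up -/

section SchemeLevel

open CategoryTheory AlgebraicGeometry TopologicalSpace Topology
open Summit.ResolutionOfSingularities.ResolutionOfSingularities.Theorems
open Summit.ResolutionOfSingularities.ResolutionOfSingularities.Theorems.WeakOrderReduction
open Summit.ResolutionOfSingularities.ResolutionOfSingularities.Theorems.RelativeDeltaCut
open Summit.ResolutionOfSingularities.ResolutionOfSingularities.Theorems.CurveLeafExit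
open Summit.ResolutionOfSingularities.ResolutionOfSingularities.Theorems.PinchCut

variable {Y : Scheme.{0}}

/-- **At a cone-shallow closed point the ideal is `n`-deep along the curve prime**: `𝓘_y ⊆ 𝔭ⁿ` and `𝔭 ⊆ 𝔪`.
[folklore] -/
theorem cone_stalkIdeal_le (I : Y.IdealSheafData) {n : ℕ} {η y : Y} (hcs : IsConeShallowAt I n η y) :
    ∃ h : η ⤳ y, stalkIdeal I y ≤ curvePrime h ^ n ∧ curvePrime h ≤ maximalIdeal (Y.presheaf.stalk y) := by
  obtain ⟨h, d, c, v, g, Φ, hP, hW', -, -, -, -, -, hJ, -⟩ := hcs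
  refine ⟨h, by rw [← hP]; exact hJ, ?_⟩
  rw [← hP, ← hW']
  exact Ideal.span_mono Set.subset_union_left

/-- **The curve prime at a cone-shallow closed point is generated by part of a regular system of parameters** (`c`
extends by `v` to a minimal basis of `𝔪`; any frame length `d + 1`). [folklore] -/
theorem isRsopPart_of_isConeShallowAt [IsLocallyNoetherian Y] (hY : Scheme.IsRegular Y) (I : Y.IdealSheafData)
    {n : ℕ} {η y : Y} (hcs : IsConeShallowAt I n η y) :
    ∃ (h : η ⤳ y) (d : ℕ) (c : Fin (d + 1) → Y.presheaf.stalk y), Ideal.span (Set.range c) = curvePrime h ∧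
      @IsRsopPart _ _ (hY y).toIsLocalRing (d + 1) c := by
  haveI := hY y
  obtain ⟨h, d, c, v, g, Φ, hP, hW', hd, -, -, -, -, -, -⟩ := hcs
  have hW : Ideal.span (Set.range (Fin.append c ![v])) = maximalIdeal _ := by
    rw [← hW', range_fin_append, Matrix.range_cons, Matrix.range_empty, Set.union_empty]
  refine ⟨h, d, c, hP, ?_⟩
  have hd' : (maximalIdeal (Y.presheaf.stalk y)).spanFinrank = (d + 1) + 1 := hd
  have := isRsopPart_comp_of_rsop hd' (Fin.append c ![v]) hW (Fin.castAdd 1) (Fin.castAdd_injective _ _)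
  convert this using 1
  funext i
  simp [Fin.append_left]

/-- **The reduced curve `cl{η}` of a uniformly cone-shallow curve is a regular scheme**: at a closed point its local
ring is `𝒪_{Y,y}/(c)` with `c` part of a regular system of parameters, at `η` it is the residue field. [folklore] -/
theorem isRegular_coneCurve_subscheme [IsLocallyNoetherian Y] (hY : Scheme.IsRegular Y)
    (I : Y.IdealSheafData) {n : ℕ} {η : Y} (hcurve : IsCurvePt η)
    (hcone : ∀ y : Y, η ⤳ y → IsClosed ({y} : Set Y) → IsConeShallowAt I n η y) :
    Scheme.IsRegular
      (Scheme.IdealSheafData.vanishingIdeal (⟨closure ({η} : Set Y), isClosed_closure⟩ : Closeds Y)).subscheme := by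
  refine isRegular_subscheme_vanishingIdeal_closure_of_forall fun z hz => ?_
  by_cases hzη : z = η
  · subst hzη
    exact isRegularLocalRing_stalk_quotient_primeOfSpecializes_self z
  · haveI := hY z
    obtain ⟨h, d, c, hP, hc⟩ := isRsopPart_of_isConeShallowAt hY I (hcone z hz (hcurve.2 z hz hzη))
    change IsRegularLocalRing (Y.presheaf.stalk z ⧸ curvePrime h)
    rw [← hP]
    exact hc.isRegularLocalRing_quotient

/-- **THE INVARIANT over a cone-shallow CLOSED point of the curve**: at every point `x'` of the curve blow-up over
it, the controlled transform `(𝓘𝒪 : 𝓘_Eⁿ)` is NOT inside `𝔪_{x'}ⁿ` (chart dictionary `IsBlowup.exists_reesChart_stalk`,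
then `cone_chart` — valid at every prime of the chart over `𝔪_y`, so at non-closed `x'` too). [folklore] -/
theorem coneInv_closed [IsLocallyNoetherian Y] (hY : Scheme.IsRegular Y) (C₀ I : Y.IdealSheafData)
    {n : ℕ} (hn : 1 ≤ n) {η : Y} (hC : ∀ (y : Y) (h : η ⤳ y), stalkIdeal C₀ y = curvePrime h)
    (x' : ↑(blowup C₀)) (hcs : IsConeShallowAt I n η (blowup.π C₀ x')) :
    ¬ stalkIdeal (controlledTransform (blowup.π C₀) C₀ I n) x' ≤ maximalIdeal _ ^ n := by
  haveI := CentreSeq.isLocallyNoetherian_blowup C₀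
  haveI := hY (blowup.π C₀ x')
  obtain ⟨h, d, c, v, g, Φ, hP, hW', hd, hdeg, hcoef, hg, hf, -, hcs⟩ := hcs
  rw [← hP] at hcs
  have hc : Ideal.span (Set.range c) = stalkIdeal C₀ (blowup.π C₀ x') := by rw [hC _ h, hP]
  obtain ⟨j, 𝔴, χ, hχ, hloc, h𝔴⟩ := (blowup.isBlowup C₀).exists_reesChart_stalk x' c hc
  have hu : ∀ l, ((blowup.π C₀).stalkMap x').hom (c l) =
      ((blowup.π C₀).stalkMap x').hom (c j) * χ (chartGen c j l) :=
    fun l => by rw [← hχ, ← hχ, ← map_mul, ← reesChartBase_apply_eq_mul_chartGen _ j l]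
  have hCmap : (stalkIdeal C₀ (blowup.π C₀ x')).map ((blowup.π C₀).stalkMap x').hom =
      Ideal.span {((blowup.π C₀).stalkMap x').hom (c j)} := by
    rw [← hc, Ideal.map_span_range_eq_span_singleton _ _ j _ hu]
  have hJ' : stalkIdeal (controlledTransform (blowup.π C₀) C₀ I n) x' =
      Submodule.colon ((stalkIdeal I (blowup.π C₀ x')).map ((blowup.π C₀).stalkMap x').hom)
        ((Ideal.span {((blowup.π C₀).stalkMap x').hom (c j)} ^ n : Ideal _) : Set _) := by
    rw [controlledTransform, stalkIdeal_colon, stalkIdeal_pow, stalkIdeal_comap_eq_map_stalkMap,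
      stalkIdeal_comap_eq_map_stalkMap, hCmap]
  rw [hJ']
  have hW : Ideal.span (Set.range (Fin.append c ![v])) = maximalIdeal _ := by
    rw [← hW', range_fin_append, Matrix.range_cons, Matrix.range_empty, Set.union_empty]
  have hd' : (maximalIdeal (Y.presheaf.stalk (blowup.π C₀ x'))).spanFinrank = (d + 1) + 1 := hd
  exact cone_chart hn c v g Φ hW hd' hdeg hcoef hg hf hcs j 𝔴 χ hloc h𝔴 _ hχ

/-- **THE INVARIANT over the GENERIC point `η` of the curve** — by PROPERNESS and POINTWISE SEMICONTINUITY: a point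
`x'` of the blow-up over `η` specialises (the blow-up is a closed map, `TowerCut.exists_specializes_over`) to a point
`x''` over the closed point `y₀` of the curve; `𝓘_{x'} ⊆ 𝔪_{x'}ⁿ` would give `𝓘_{x''} ⊆ 𝔪_{x''}ⁿ`
(`stalkIdeal_le_pow_of_specializes`, `𝒪_{x''}` regular), against `coneInv_closed` at `x''`. [folklore] -/
theorem coneInv_eta [IsLocallyNoetherian Y] (hY : Scheme.IsRegular Y) (C₀ I : Y.IdealSheafData) {n : ℕ}
    (hn : 1 ≤ n) {η y₀ : Y} (hy₀ : η ⤳ y₀) (hC : ∀ (y : Y) (h : η ⤳ y), stalkIdeal C₀ y = curvePrime h)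
    (hY₁ : Scheme.IsRegular ↑(blowup C₀)) (hcs : IsConeShallowAt I n η y₀) (x' : ↑(blowup C₀))
    (hx' : blowup.π C₀ x' = η) :
    ¬ stalkIdeal (controlledTransform (blowup.π C₀) C₀ I n) x' ≤ maximalIdeal _ ^ n := by
  haveI := CentreSeq.isLocallyNoetherian_blowup C₀
  haveI : IsProper (blowup.π C₀) := (blowup.isBlowup C₀).isProper
  obtain ⟨x'', hxx, hπx⟩ := TowerCut.exists_specializes_over (blowup.π C₀) (blowup.π C₀).isClosedMap x'
    (y₀ := y₀) (by rw [hx']; exact hy₀)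
  intro hle
  haveI := hY₁ x''
  have hcs'' : IsConeShallowAt I n η (blowup.π C₀ x'') := by rw [hπx]; exact hcs
  exact coneInv_closed hY C₀ I hn hC x'' hcs''
    (stalkIdeal_le_pow_of_specializes hxx (controlledTransform (blowup.π C₀) C₀ I n) hle)

end SchemeLevel

end Summit.ResolutionOfSingularities.ResolutionOfSingularities.Theorems.ShallowCut
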